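import Summits.FinalStateConjecture.FinalStateConjecture.Theorems.ClusterCompletenessOmegaLimitMultiKerrBackgroundOmegaLimits
import HarnessLib

/-!
# Route ClusterCompleteness · crux `OmegaLimitMultiKerr` — JOINT ω-limits of finitely many charts
# along one common subsequence

Structure lemma for the crux stmt-FinalStateConjecture-14664 (`ClusterCompleteness.OmegaLimitMultiKerr`,
rank 9), line `Sketch`, lead gen 3. The recur-disjunct `Recurs k 𝒟` asks closeness of ALL `N` hole
charts (and the flat chart) at the SAME late times (`∃ᶠ τ, … ∧ ∀ i, …`; sequential form
`recurs_iff_exists_seq`: one sequence `T n → ∞` for all holes). Per-hole ω-limits are not enough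
(`liminf_τ maxᵢ ≠ maxᵢ liminf_τ`, idea card `select-and-rebase`): the identification chain needs the
ω-limits of all holes along ONE common subsequence. This file extracts them:

**Theorem (`exists_strictMono_forall_omegaLimit_translate`).** Given finitely many systems
`(Bᵢ, eᵢ, hᵢ)`, `i : Fin N`, each as in `exists_omegaLimit_translate_of_bounded_truncLateRegion`
(background with a time-translation vector, field `C^{k+1}`-bounded on the truncated late regions),
and ONE sequence of times `T n → ∞`, there is ONE strictly increasing `φ` such that for EVERY `i` the
translates `hᵢ (· + T (φ n) • eᵢ)` converge in `Cᵏ` on compacts of `Bᵢ.domain` to a `Cᵏ` field `gᵢ`.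

Proof: induction on `N`, extracting for the last system along the subsequence already obtained for
the first `N` (a subsequence of a convergent sequence converges). Hale 1980, Ch. I, §8.
-/

-- every `Summit.FinalStateConjecture.FinalStateConjecture.…` name repeats the summit = sub-problem segment (D-0017 layout)
set_option linter.dupNamespace false

noncomputable section

open Set Filter Topology Function TopologicalSpace
open scoped ContDiff Topology ENNReal

namespace Summit.FinalStateConjecture.FinalStateConjecture.Theorems.ClusterCompleteness

open Literature.Geometry.Lorentzian

/-- **Joint `Cᵏ_loc` ω-limits of finitely many tame charts along one common subsequence.** For
systems `(Bᵢ, eᵢ, hᵢ)`, `i : Fin N` — `Bᵢ` a background whose domain and radius are invariant and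
whose time is shifted under `x ↦ x + s • eᵢ` (time and radius continuous), `hᵢ` of class `C^{k+1}`
on the domain with bounded derivatives of order `≤ k + 1` on every truncated late region — and one
sequence `T n → +∞`, a single strictly increasing `φ` makes ALL translates `hᵢ (· + T (φ n) • eᵢ)`
converge in `Cᵏ` on compacts of `Bᵢ.domain` to `Cᵏ` fields `gᵢ` (induction on `N` through
`exists_omegaLimit_translate_of_bounded_truncLateRegion`; Hale 1980, Ch. I, §8).
[cite: Hale1980, Ch. I §8] -/
theorem exists_strictMono_forall_omegaLimit_translate :
    ∀ {W : Type*} [NormedAddCommGroup W] [NormedSpace ℝ W] [FiniteDimensional ℝ W]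
      (N : ℕ) (B : Fin N → ModelBackground) (e : Fin N → E4),
      (∀ i, ∀ x ∈ ((B i).domain : Set E4), ∀ s : ℝ, x + s • e i ∈ ((B i).domain : Set E4)) →
      (∀ i (x : E4) (s : ℝ), (B i).time (x + s • e i) = (B i).time x + s) →
      (∀ i (x : E4) (s : ℝ), (B i).radius (x + s • e i) = (B i).radius x) →
      (∀ i, Continuous (B i).time) → (∀ i, Continuous (B i).radius) →
      ∀ {k : ℕ} {h : Fin N → E4 → W}, (∀ i, ContDiffOn ℝ (k + 1) (h i) ((B i).domain : Set E4)) →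
      ∀ {τ₀ : ℝ}, (∀ i (R : ℝ), ∃ C : ℝ, ∀ j, j ≤ k + 1 →
        ∀ x ∈ Subtype.val '' (B i).truncLateRegion τ₀ R, ‖iteratedFDeriv ℝ j (h i) x‖ ≤ C) →
      ∀ {T : ℕ → ℝ}, Tendsto T atTop atTop →
      ∃ φ : ℕ → ℕ, StrictMono φ ∧ ∀ i, ∃ g : E4 → W, ContDiffOn ℝ k g ((B i).domain : Set E4) ∧
        ∀ K ⊆ ((B i).domain : Set E4), IsCompact K →
          Tendsto (fun n ↦ supCkENorm K k (fun x ↦ h i (x + T (φ n) • e i) - g x)) atTop (𝓝 0) := by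
  intro W _ _ _ N
  induction N with
  | zero =>
    intro B e _ _ _ _ _ k h _ τ₀ _ T _
    exact ⟨id, strictMono_id, fun i ↦ i.elim0⟩
  | succ N ih =>
    intro B e hdom htime hrad htc hrc k h hh τ₀ hb T hT
    -- the first `N` systems along `T`
    obtain ⟨φ₁, hφ₁, hlim₁⟩ := ih (fun i ↦ B i.castSucc) (fun i ↦ e i.castSucc)
      (fun i ↦ hdom i.castSucc) (fun i ↦ htime i.castSucc) (fun i ↦ hrad i.castSucc)
      (fun i ↦ htc i.castSucc) (fun i ↦ hrc i.castSucc) (h := fun i ↦ h i.castSucc)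
      (fun i ↦ hh i.castSucc) (τ₀ := τ₀) (fun i R ↦ hb i.castSucc R) hT
    -- the last system along `T ∘ φ₁`
    have hT₁ : Tendsto (T ∘ φ₁) atTop atTop := hT.comp hφ₁.tendsto_atTop
    obtain ⟨g, φ₂, hφ₂, hg, hlim₂⟩ :=
      exists_omegaLimit_translate_of_bounded_truncLateRegion (B (Fin.last N)) (e (Fin.last N))
        (hdom _) (htime _) (hrad _) (htc _) (hrc _) (hh _) (hb _) hT₁
    refine ⟨φ₁ ∘ φ₂, hφ₁.comp hφ₂, fun i ↦ ?_⟩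
    rcases Fin.eq_castSucc_or_eq_last i with ⟨j, rfl⟩ | rfl
    · obtain ⟨gj, hgj, hlimj⟩ := hlim₁ j
      exact ⟨gj, hgj, fun K hKO hK ↦ (hlimj K hKO hK).comp hφ₂.tendsto_atTop⟩
    · exact ⟨g, hg, fun K hKO hK ↦ hlim₂ K hKO hK⟩

end Summit.FinalStateConjecture.FinalStateConjecture.Theorems.ClusterCompleteness

end
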